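import Mathlib
import Summits.NavierStokesRegularity.NavierStokesRegularity.Theorems.EulerZoomLiouvillePowerGaugeEulerLiouvilleQVorticityInequality
import Summits.NavierStokesRegularity.NavierStokesRegularity.Theorems.EulerZoomLiouvillePowerGaugeEulerLiouvillePastIrrotational
import HarnessLib.Audit

/-!
# Crux E `PowerGaugeEulerLiouville` (stmt-NavierStokesRegularity-19832): LOG-TIME BREATHERS WITH VORTICITY IN `L^q`, `q` SMALL, are trivial
# (line `logtime-breathers`, residue T3; LEAD ns-typeII-p2's key K-B «small-q breathers», the breather twin of Chae–Tsai's
# flow-Jacobian stratum `VorticityDecay.ae_eq_zero_of_gauge_of_dss_smallq`)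

Route `EulerZoomLiouville` (NavierStokesRegularity), crux E.  A LOG-TIME BREATHER `u(τ, y) = e^{cτ} V(e^{−cτ} y)` (`τ < 0`, `c > 0`)
has `∇u(τ, y) = ∇V(e^{−cτ}y)`, hence `curl u(τ, y) = curl V(e^{−cτ} y)` and, for every exponent `q > 0`,
`∫|curl u(τ)|^q dy = e^{3cτ} ∫|curl V|^q` EXACTLY (`integral_rpow_curl_breather`).  On the other hand the `q`-enstrophy of a
classical Euler flow with `‖∇u‖ ≤ L` grows at most like `e^{qLΔτ}` FORWARD in time: the weighted `q`-enstrophy identity of the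
tree (`VorticityDecay.integral_weight_rpow_sub_eq`) with the CONSTANT weight gives
`∫|ω(b)|^q ≤ ∫|ω(a)|^q + qL ∫ₐᵇ∫|ω|^q` (`integral_rpow_curl_le_add`, the mirror of `VorticityDecay.integral_weight_rpow_ge`).
With `∫ₐᵇ e^{3cσ}dσ = (e^{3cb} − e^{3ca})/(3c)` this reads `I (e^{3cb} − e^{3ca})(1 − qL/(3c)) ≤ 0`, `I = ∫|curl V|^q`; so for
`qL < 3c` the profile is IRROTATIONAL and the tree's irrotational endgame `PastIrrotational.ae_eq_zero_of_gauge_of_pastIrrotational`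
concludes (`ae_eq_zero_of_gauge_of_smallqBreather`).  Hypotheses on the profile: `‖V‖ ≤ B` (the identity needs a bounded velocity on
time strips), `‖∇V‖ ≤ L`, `|curl V|^q` integrable with `0 < q`, `qL < 3c` — no decay RATE of the vorticity is assumed (compare the
steep-vorticity twin `…LogtimeBreatherSteepVorticity`, `‖curl V(z)‖ ≤ D(1+‖z‖)^{−k}`, `kc > L`).

WHAT THIS IS NOT: not NS regularity, not the crux E — one more classical breather stratum for the LEAD skeleton (5th disjunct of
`IsTameBreather`); the rest of T3 stays OPEN.  [folklore; Chae–Tsai MRL 21 (2014) Thm 2.1 mechanism in log-time breathing variables]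
-/

noncomputable section

set_option linter.dupNamespace false

open MeasureTheory Set Filter Topology Metric Function
open scoped NNReal ENNReal ContDiff InnerProductSpace RealInnerProductSpace

namespace Summit.NavierStokesRegularity.NavierStokesRegularity.Theorems.PowerGaugeEulerLiouville.LogtimeBreather

open Literature.Analysis Literature.Analysis.FluidPDE
open Summit.NavierStokesRegularity.NavierStokesRegularity.Theorems.PowerGaugeEulerLiouville.VorticityDecay

/-! ### The forward `q`-enstrophy bound (constant weight) -/

section Forward

variable {T : ℝ} {v : ℝ → EuclideanSpace ℝ (Fin 3) → EuclideanSpace ℝ (Fin 3)} {p : ℝ → EuclideanSpace ℝ (Fin 3) → ℝ}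

/-- **Forward `q`-enstrophy bound.**  For a classical Euler flow on `[0, T]` (`T > 0`) with `‖u‖, ‖∇u‖ ≤ B`, `‖∇u‖ ≤ κ` (`κ ≥ 0`),
an exponent `q > 0` and `∫|curl u(σ)|^q ≤ N` on `[0, T]` (`|curl u(σ)|^q` integrable):
`∫|ω(T)|^q ≤ ∫|ω(0)|^q + qκ ∫₀ᵀ∫|ω(σ)|^q dσ` (the tree's weighted identity with the constant weight `Θ ≡ 1`, the stretching
term bounded by `|⟪ξ, Du ξ⟫| ≤ κ`). [folklore] -/
theorem integral_rpow_curl_le_add (hT : 0 < T) (hv : IsClassicalNSSolutionOn (Icc 0 T) 0 0 v p)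
    {B : ℝ} (hB : ∀ σ ∈ Icc 0 T, ∀ y, ‖v σ y‖ ≤ B ∧ ‖fderiv ℝ (v σ) y‖ ≤ B)
    {κ : ℝ} (hκ0 : 0 ≤ κ) (hκ : ∀ σ ∈ Icc 0 T, ∀ y, ‖fderiv ℝ (v σ) y‖ ≤ κ)
    {q : ℝ} (hq : 0 < q) {N : ℝ}
    (hLq : ∀ σ ∈ Icc 0 T, Integrable (fun y => ‖curl (v σ) y‖ ^ q) ∧ ∫ y, ‖curl (v σ) y‖ ^ q ≤ N) :
    ∫ x, ‖curl (v T) x‖ ^ q ≤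
      (∫ x, ‖curl (v 0) x‖ ^ q) + q * κ * ∫ σ in Ioo 0 T, ∫ x, ‖curl (v σ) x‖ ^ q := by
  -- the constant weight
  set Θ : ℝ → EuclideanSpace ℝ (Fin 3) → ℝ := fun _ _ => 1 with hΘ
  have hΘs : IsSmoothSpaceTimeOn (Icc 0 T) Θ := contDiffOn_const
  have hΘM : ∀ σ ∈ Icc 0 T, ∀ y : EuclideanSpace ℝ (Fin 3), |Θ σ y| ≤ 1 ∧
      |FluidPDE.timeDerivWithin (Icc 0 T) Θ σ y| ≤ 0 ∧ ‖fderiv ℝ (Θ σ) y‖ ≤ 0 := by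
    intro σ hσ y
    simp [hΘ, FluidPDE.timeDerivWithin]
  have hid := integral_weight_rpow_sub_eq hT hv hB hΘs hΘM hq hLq
  have hsrc0 : ∀ σ : ℝ, ∀ x : EuclideanSpace ℝ (Fin 3),
      Θ σ x * (FluidPDE.timeDerivWithin (Icc 0 T) Θ σ x + fderiv ℝ (Θ σ) x (v σ x)) = 0 := by
    intro σ x
    simp [hΘ, FluidPDE.timeDerivWithin]
  simp only [hsrc0, zero_mul, integral_zero, add_zero] at hid
  simp only [hΘ, one_pow, one_mul, mul_one] at hid
  -- integrability of the stretching term and its bound at each time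
  have hωc : ∀ σ ∈ Icc 0 T, Continuous (curl (v σ)) := fun σ hσ =>
    (contDiff_curl (n := 0) ((hv.contDiff_velocity hσ).of_le (by norm_cast))).continuous
  have hAc : ∀ σ ∈ Icc 0 T, Continuous (fun x => fderiv ℝ (v σ) x) := fun σ hσ =>
    (hv.contDiff_velocity hσ).continuous_fderiv (by simp)
  have hstc : ∀ σ ∈ Icc 0 T, Continuous (fun x => ‖curl (v σ) x‖ ^ q *
      ⟪‖curl (v σ) x‖⁻¹ • curl (v σ) x, fderiv ℝ (v σ) x (‖curl (v σ) x‖⁻¹ • curl (v σ) x)⟫) := by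
    intro σ hσ
    have h := (continuous_qstretch hq).comp ((hωc σ hσ).prodMk (hAc σ hσ))
    exact h.congr fun x => rfl
  have hIst : ∀ σ ∈ Icc 0 T, Integrable (fun x => (q / 2) * (‖curl (v σ) x‖ ^ q *
      ⟪‖curl (v σ) x‖⁻¹ • curl (v σ) x, fderiv ℝ (v σ) x (‖curl (v σ) x‖⁻¹ • curl (v σ) x)⟫)) := by
    intro σ hσ
    refine (Integrable.mono' ((hLq σ hσ).1.const_mul B) (hstc σ hσ).aestronglyMeasurable
      (Eventually.of_forall fun x => ?_)).const_mul _
    rw [Real.norm_eq_abs]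
    exact (abs_qstretch_le q _ _).trans (mul_le_mul_of_nonneg_right (hB σ hσ x).2
      (Real.rpow_nonneg (norm_nonneg _) _))
  have hup : ∀ σ ∈ Icc 0 T,
      (∫ x, (q / 2) * (‖curl (v σ) x‖ ^ q *
          ⟪‖curl (v σ) x‖⁻¹ • curl (v σ) x, fderiv ℝ (v σ) x (‖curl (v σ) x‖⁻¹ • curl (v σ) x)⟫)) ≤
        (q / 2 * κ) * ∫ x, ‖curl (v σ) x‖ ^ q := by
    intro σ hσ
    rw [← integral_const_mul]
    refine integral_mono (hIst σ hσ) ((hLq σ hσ).1.const_mul _) fun x => ?_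
    beta_reduce
    have hq0 : 0 ≤ ‖curl (v σ) x‖ ^ q := Real.rpow_nonneg (norm_nonneg _) _
    have hst := (abs_le.1 ((abs_qstretch_le q (curl (v σ) x) (fderiv ℝ (v σ) x)).trans
      (mul_le_mul_of_nonneg_right (hκ σ hσ x) hq0))).2
    calc (q / 2) * (‖curl (v σ) x‖ ^ q *
          ⟪‖curl (v σ) x‖⁻¹ • curl (v σ) x, fderiv ℝ (v σ) x (‖curl (v σ) x‖⁻¹ • curl (v σ) x)⟫)
        ≤ (q / 2) * (κ * ‖curl (v σ) x‖ ^ q) := mul_le_mul_of_nonneg_left hst (by positivity)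
      _ = q / 2 * κ * ‖curl (v σ) x‖ ^ q := by ring
  -- integrate in time
  obtain ⟨hJ, hJb⟩ := integrableOn_weight_rpow hT hv hΘs (fun σ hσ y => (hΘM σ hσ y).1) hq hLq
  simp only [hΘ, one_pow, one_mul] at hJ hJb
  set g : ℝ → ℝ := fun σ => ∫ x, (q / 2) * (‖curl (v σ) x‖ ^ q *
      ⟪‖curl (v σ) x‖⁻¹ • curl (v σ) x, fderiv ℝ (v σ) x (‖curl (v σ) x‖⁻¹ • curl (v σ) x)⟫) with hg
  have hstep : (∫ σ in Ioo 0 T, g σ) ≤ (q / 2 * κ) * ∫ σ in Ioo 0 T, ∫ x, ‖curl (v σ) x‖ ^ q := by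
    by_cases hgi : IntegrableOn g (Ioo 0 T)
    · rw [← integral_const_mul]
      exact setIntegral_mono_on hgi (hJ.const_mul _) measurableSet_Ioo fun σ hσ => hup σ (Ioo_subset_Icc_self hσ)
    · rw [integral_undef hgi]
      have h0 : 0 ≤ ∫ σ in Ioo 0 T, ∫ x, ‖curl (v σ) x‖ ^ q :=
        setIntegral_nonneg measurableSet_Ioo fun σ hσ => (hJb σ (Ioo_subset_Icc_self hσ)).1
      positivity
  have hid' : 2⁻¹ * (∫ x, ‖curl (v T) x‖ ^ q) - 2⁻¹ * (∫ x, ‖curl (v 0) x‖ ^ q) = ∫ σ in Ioo 0 T, g σ := by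
    rw [hid]
  nlinarith [hstep, hid']

end Forward

/-! ### Breather calculus -/

section Breather

variable {u : ℝ → EuclideanSpace ℝ (Fin 3) → EuclideanSpace ℝ (Fin 3)} {p : ℝ → EuclideanSpace ℝ (Fin 3) → ℝ}
  {c : ℝ} {V : EuclideanSpace ℝ (Fin 3) → EuclideanSpace ℝ (Fin 3)}

/-- The profile of a classical breather is `C¹`: `V(z) = e^{c} u(−1, e^{−c} z)`. [folklore] -/
theorem contDiff_profile (hcl : IsClassicalEulerSolutionOn (Iio 0) 0 u p)
    (hbr : ∀ τ : ℝ, τ < 0 → ∀ y, u τ y = Real.exp (c * τ) • V (Real.exp (-(c * τ)) • y)) : ContDiff ℝ 2 V := by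
  -- adapted from …LogtimeBreatherSteepVorticity
  have hVrep : V = fun z => Real.exp c • u (-1) (Real.exp (-c) • z) := by
    funext z
    have h := hbr (-1) (by norm_num) (Real.exp (-c) • z)
    rw [mul_neg_one, neg_neg, smul_smul, ← Real.exp_add, add_neg_cancel, Real.exp_zero, one_smul] at h
    rw [h, smul_smul, ← Real.exp_add, add_neg_cancel, Real.exp_zero, one_smul]
  rw [hVrep]
  have h1 : ContDiff ℝ 2 (u (-1)) := (hcl.contDiff_velocity (by norm_num : (-1 : ℝ) < 0)).of_le (by norm_cast)
  exact (h1.comp (contDiff_const_smul _)).const_smul _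

/-- `∇u(s, y) = ∇V(e^{−cs} y)` for a breather with differentiable profile. [folklore] -/
theorem fderiv_breather (hVd : Differentiable ℝ V)
    (hbr : ∀ τ : ℝ, τ < 0 → ∀ y, u τ y = Real.exp (c * τ) • V (Real.exp (-(c * τ)) • y))
    {s : ℝ} (hs : s < 0) (y : EuclideanSpace ℝ (Fin 3)) :
    fderiv ℝ (u s) y = fderiv ℝ V (Real.exp (-(c * s)) • y) := by
  -- adapted from …LogtimeBreatherSteepVorticity
  have hus : u s = fun y => Real.exp (c * s) • V (Real.exp (-(c * s)) • y) := funext (hbr s hs)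
  have h : HasFDerivAt (u s) (fderiv ℝ V (Real.exp (-(c * s)) • y)) y := by
    rw [hus]
    have h1 : HasFDerivAt (fun y : EuclideanSpace ℝ (Fin 3) => Real.exp (-(c * s)) • y)
        (Real.exp (-(c * s)) • ContinuousLinearMap.id ℝ (EuclideanSpace ℝ (Fin 3))) y :=
      (ContinuousLinearMap.id ℝ (EuclideanSpace ℝ (Fin 3))).hasFDerivAt.const_smul (Real.exp (-(c * s)))
    have h2 := ((hVd (Real.exp (-(c * s)) • y)).hasFDerivAt.comp y h1).const_smul (Real.exp (c * s))
    refine h2.congr_fderiv ?_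
    ext v
    simp only [FunLike.coe_smul, Pi.smul_apply, ContinuousLinearMap.comp_apply, ContinuousLinearMap.id_apply,
      map_smul, smul_smul, ← Real.exp_add, add_neg_cancel, Real.exp_zero, one_smul]
  exact h.fderiv

/-- `curl u(s, y) = curl V(e^{−cs} y)`. [folklore] -/
theorem curl_breather (hVd : Differentiable ℝ V)
    (hbr : ∀ τ : ℝ, τ < 0 → ∀ y, u τ y = Real.exp (c * τ) • V (Real.exp (-(c * τ)) • y))
    {s : ℝ} (hs : s < 0) (y : EuclideanSpace ℝ (Fin 3)) :
    curl (u s) y = curl V (Real.exp (-(c * s)) • y) := by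
  unfold curl
  rw [fderiv_breather hVd hbr hs y]

/-- **The `q`-enstrophy of a breather**: `∫|curl u(s)|^q dy = e^{3cs} ∫|curl V|^q` and `|curl u(s)|^q` is integrable when
`|curl V|^q` is. [folklore] -/
theorem integral_rpow_curl_breather (hVd : Differentiable ℝ V)
    (hbr : ∀ τ : ℝ, τ < 0 → ∀ y, u τ y = Real.exp (c * τ) • V (Real.exp (-(c * τ)) • y))
    {q : ℝ} (hVq : Integrable (fun z => ‖curl V z‖ ^ q)) {s : ℝ} (hs : s < 0) :
    Integrable (fun y => ‖curl (u s) y‖ ^ q) ∧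
      ∫ y, ‖curl (u s) y‖ ^ q = Real.exp (3 * c * s) * ∫ z, ‖curl V z‖ ^ q := by
  have hfun : (fun y => ‖curl (u s) y‖ ^ q) = fun y => (fun z => ‖curl V z‖ ^ q) (Real.exp (-(c * s)) • y) :=
    funext fun y => by simp only [curl_breather hVd hbr hs y]
  rw [hfun]
  refine ⟨hVq.comp_smul (Real.exp_pos _).ne', ?_⟩
  rw [Measure.integral_comp_smul volume (fun z => ‖curl V z‖ ^ q) (Real.exp (-(c * s))), finrank_euclideanSpace_fin,
    smul_eq_mul]
  congr 1
  rw [abs_of_pos (inv_pos.2 (pow_pos (Real.exp_pos _) 3)), ← Real.exp_nat_mul, ← Real.exp_neg]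
  congr 1
  push_cast
  ring

/-- **LOG-TIME BREATHERS WITH `curl V ∈ L^q`, `qL < 3c`, ARE TRIVIAL** (LEAD ns-typeII-p2's key K-B; binders = the line's
`IsLogtimeBreather u c V` unfolded + a bounded profile with bounded gradient `‖∇V‖ ≤ L` + `∫|curl V|^q < ∞` for ONE exponent
`0 < q < 3c/L`).  Crux hypotheses verbatim (`0 < ρ ≤ ½`) + `(u, p)` classical Euler on the past ⇒ `u = 0` a.e. on `(−∞, 0) × ℝ³`.
[folklore; Chae–Tsai MRL 21 (2014) Thm 2.1 mechanism; line card `Lines/logtime-breathers.md` T3] -/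
theorem ae_eq_zero_of_gauge_of_smallqBreather {ρ : ℝ} (hρ : 0 < ρ) (hρh : ρ ≤ 1 / 2)
    {H : ℝ → EuclideanSpace ℝ (Fin 3) → EuclideanSpace ℝ (Fin 3) →L[ℝ] EuclideanSpace ℝ (Fin 3)} {c₀ : ℝ≥0}
    (hsw : IsSuitableWeakSolutionOn (slab (EuclideanSpace ℝ (Fin 3)) (Iio 0) isOpen_Iio) 0 0 u p)
    (hH : HasWeakSpatialGradientOn (slab (EuclideanSpace ℝ (Fin 3)) (Iio 0) isOpen_Iio) u H)
    (hgauge : ∀ a : ℝ, 0 < a →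
      ENNReal.ofReal (a ^ (2 * ρ)) * cknA a (0 : ℝ × EuclideanSpace ℝ (Fin 3)) u +
          ENNReal.ofReal (a ^ ρ) * cknE a (0 : ℝ × EuclideanSpace ℝ (Fin 3)) H +
        ENNReal.ofReal (a ^ (2 * ρ)) * cknD a (0 : ℝ × EuclideanSpace ℝ (Fin 3)) p ≤ (c₀ : ℝ≥0∞))
    (hcl : IsClassicalEulerSolutionOn (Iio 0) 0 u p) (hc : 0 < c)
    (hbr : c ≠ 0 ∧ ∀ τ : ℝ, τ < 0 → ∀ y, u τ y = Real.exp (c * τ) • V (Real.exp (-(c * τ)) • y))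
    {B L q : ℝ} (hVb : ∀ z, ‖V z‖ ≤ B) (hVgrad : ∀ z, ‖fderiv ℝ V z‖ ≤ L) (hq : 0 < q) (hqL : q * L < 3 * c)
    (hVq : Integrable (fun z => ‖curl V z‖ ^ q)) :
    uncurry u =ᵐ[volume.restrict (Iio (0 : ℝ) ×ˢ (univ : Set (EuclideanSpace ℝ (Fin 3))))] 0 := by
  obtain ⟨-, hbr⟩ := hbr
  have hV2 : ContDiff ℝ 2 V := contDiff_profile hcl hbr
  have hVd : Differentiable ℝ V := hV2.differentiable (by norm_num)
  have hL0 : 0 ≤ L := (norm_nonneg _).trans (hVgrad 0)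
  set I : ℝ := ∫ z, ‖curl V z‖ ^ q with hI
  have hI0 : 0 ≤ I := integral_nonneg fun z => Real.rpow_nonneg (norm_nonneg _) _
  -- uniform bounds on the past
  have hvel : ∀ s : ℝ, s < 0 → ∀ y, ‖u s y‖ ≤ max B L := by
    intro s hs y
    rw [hbr s hs y, norm_smul, Real.norm_eq_abs, abs_of_pos (Real.exp_pos _)]
    have h1 : Real.exp (c * s) ≤ 1 := Real.exp_le_one_iff.2 (by nlinarith)
    have hB0 : 0 ≤ B := (norm_nonneg _).trans (hVb 0)
    calc Real.exp (c * s) * ‖V (Real.exp (-(c * s)) • y)‖ ≤ 1 * B :=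
          mul_le_mul h1 (hVb _) (norm_nonneg _) zero_le_one
      _ ≤ max B L := by rw [one_mul]; exact le_max_left _ _
  have hgrad : ∀ s : ℝ, s < 0 → ∀ y, ‖fderiv ℝ (u s) y‖ ≤ L := fun s hs y => by
    rw [fderiv_breather hVd hbr hs y]; exact hVgrad _
  -- the forward bound on `[a, b] = [-2, -1]`, in shifted time `σ ↦ σ + a`
  have hsub : Icc (0 : ℝ) 1 ⊆ (fun σ : ℝ => σ + -2) ⁻¹' Iio (0 : ℝ) := by
    intro σ hσ; show σ + -2 < 0; linarith [hσ.2]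
  have hv : IsClassicalNSSolutionOn (Icc (0 : ℝ) 1) 0 0 (fun σ => u (σ + -2)) (fun σ => p (σ + -2)) :=
    (hcl.comp_add_right (-2)).mono hsub (uniqueDiffOn_Icc one_pos)
  have hBt : ∀ σ ∈ Icc (0 : ℝ) 1, ∀ y, ‖u (σ + -2) y‖ ≤ max B L ∧ ‖fderiv ℝ (u (σ + -2)) y‖ ≤ max B L :=
    fun σ hσ y => ⟨hvel _ (hsub hσ) y, (hgrad _ (hsub hσ) y).trans (le_max_right _ _)⟩
  have hκ : ∀ σ ∈ Icc (0 : ℝ) 1, ∀ y, ‖fderiv ℝ (u (σ + -2)) y‖ ≤ L := fun σ hσ y => hgrad _ (hsub hσ) y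
  have hLq : ∀ σ ∈ Icc (0 : ℝ) 1, Integrable (fun y => ‖curl (u (σ + -2)) y‖ ^ q) ∧
      ∫ y, ‖curl (u (σ + -2)) y‖ ^ q ≤ I := by
    intro σ hσ
    obtain ⟨hint, heq⟩ := integral_rpow_curl_breather hVd hbr hVq (hsub hσ)
    refine ⟨hint, ?_⟩
    rw [heq]
    have : Real.exp (3 * c * (σ + -2)) ≤ 1 := Real.exp_le_one_iff.2 (by nlinarith [hσ.2])
    nlinarith
  have hfwd := integral_rpow_curl_le_add one_pos hv hBt hL0 hκ hq hLq
  -- the three `q`-enstrophies in closed form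
  have e1 : ∫ x, ‖curl (u ((1 : ℝ) + -2)) x‖ ^ q = Real.exp (3 * c * (-1)) * I := by
    rw [show (1 : ℝ) + -2 = -1 by norm_num]; exact (integral_rpow_curl_breather hVd hbr hVq (by norm_num)).2
  have e0 : ∫ x, ‖curl (u ((0 : ℝ) + -2)) x‖ ^ q = Real.exp (3 * c * (-2)) * I := by
    rw [show (0 : ℝ) + -2 = -2 by norm_num]; exact (integral_rpow_curl_breather hVd hbr hVq (by norm_num)).2
  have eI : ∫ σ in Ioo (0 : ℝ) 1, ∫ x, ‖curl (u (σ + -2)) x‖ ^ q =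
      (3 * c)⁻¹ * (Real.exp (3 * c * (-1)) - Real.exp (3 * c * (-2))) * I := by
    have hpt : ∀ σ ∈ Ioo (0 : ℝ) 1, ∫ x, ‖curl (u (σ + -2)) x‖ ^ q = Real.exp (3 * c * σ + 3 * c * (-2)) * I := by
      intro σ hσ
      rw [(integral_rpow_curl_breather hVd hbr hVq (hsub (Ioo_subset_Icc_self hσ))).2]
      congr 1; congr 1; ring
    rw [setIntegral_congr_fun measurableSet_Ioo hpt, ← integral_Ioc_eq_integral_Ioo,
      ← intervalIntegral.integral_of_le zero_le_one, intervalIntegral.integral_mul_const,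
      intervalIntegral.integral_comp_mul_add (fun x => Real.exp x) (by positivity : (3 : ℝ) * c ≠ 0), integral_exp]
    simp only [mul_one, mul_zero, zero_add, smul_eq_mul]
    ring_nf
  rw [e1, e0, eI] at hfwd
  -- `I (e^{-3c} - e^{-6c}) (1 - qL/(3c)) ≤ 0` forces `I = 0`
  have hexp : Real.exp (3 * c * (-2)) < Real.exp (3 * c * (-1)) := Real.exp_lt_exp.2 (by nlinarith)
  have hIle : I = 0 := by
    by_contra hne
    have hIpos : 0 < I := lt_of_le_of_ne hI0 (Ne.symm hne)
    have h3c : 0 < 3 * c := by positivity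
    -- rewrite the forward bound as `3c·(Eb − Ea)·I ≤ qL·(Eb − Ea)·I`
    have key : 3 * c * ((Real.exp (3 * c * (-1)) - Real.exp (3 * c * (-2))) * I) ≤
        q * L * ((Real.exp (3 * c * (-1)) - Real.exp (3 * c * (-2))) * I) := by
      have h1 : 3 * c * (q * L * ((3 * c)⁻¹ * (Real.exp (3 * c * (-1)) - Real.exp (3 * c * (-2))) * I)) =
          q * L * ((Real.exp (3 * c * (-1)) - Real.exp (3 * c * (-2))) * I) := by
        field_simp
      have h2 := mul_le_mul_of_nonneg_left hfwd h3c.le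
      rw [mul_add, h1] at h2
      linarith
    have hpos : 0 < (Real.exp (3 * c * (-1)) - Real.exp (3 * c * (-2))) * I := mul_pos (by linarith) hIpos
    nlinarith
  -- the profile, hence every slice, is irrotational
  have hcurlV : ∀ z, curl V z = 0 := by
    have hcont : Continuous fun z => ‖curl V z‖ ^ q :=
      ((contDiff_curl (n := 0) (hV2.of_le (by norm_cast))).continuous.norm).rpow_const fun _ => Or.inr hq.le
    have hae : (fun z => ‖curl V z‖ ^ q) =ᵐ[volume] 0 :=
      (integral_eq_zero_iff_of_nonneg (fun z => Real.rpow_nonneg (norm_nonneg _) _) hVq).1 hIle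
    have hzero : (fun z => ‖curl V z‖ ^ q) = 0 := (hcont.ae_eq_iff_eq volume continuous_const).1 hae
    intro z
    have hz := congrFun hzero z
    simp only [Pi.zero_apply] at hz
    have : ‖curl V z‖ = 0 := by
      rcases (Real.rpow_eq_zero_iff_of_nonneg (norm_nonneg _)).1 hz with ⟨h, -⟩
      exact h
    exact norm_eq_zero.1 this
  have hcurl : ∀ τ : ℝ, τ < 0 → ∀ x, curl (u τ) x = 0 := fun τ hτ x => by
    rw [curl_breather hVd hbr hτ x]; exact hcurlV _
  exact PastIrrotational.ae_eq_zero_of_gauge_of_pastIrrotational hρ hρh hsw hH hgauge le_rfl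
    (fun τ hτ => (hcl.contDiff_velocity hτ).of_le (by norm_cast)) (fun τ hτ => hcl.divFree τ hτ) hcurl

end Breather

end Summit.NavierStokesRegularity.NavierStokesRegularity.Theorems.PowerGaugeEulerLiouville.LogtimeBreather

end
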